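import Literature.Probability.Percolation.CriticalContinuity
import Literature.Probability.Percolation.SharpnessDCTProofs
import Literature.Probability.Percolation.LatticeWalksGM
import Literature.Probability.Percolation.RSW
import HarnessLib

/-!
# `BGNOffTheFloor` (stmt-CriticalPhenomena-7773), line `registered` (birth) — STUB 1 `stub_levelMono`

Crux `Summit.CriticalPhenomena.PercolationContinuityZ3.Theses.PercGamblersRuin.BGNOffTheFloor`
(item stmt-CriticalPhenomena-7773), line `registered` (= `Cruxes/BGNOffTheFloor/Lines/birth.lean`),
stub `stub_levelMono` (STUB 1 of the line's skeleton).

Write `R = {z : ℤ³ | -a·n < z₀}` (the region above the floor) and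
`E_n(a,b) = {ω | ∃ y, y₀ = b·n ∧ ω ∈ {0 ⟷ y in R}}` (the climb event of the crux),
`e_n(a,b) = P_{p_c}(E_n(a,b))`.

Statement proved (CEILING MONOTONICITY): `b ≤ b' → e_n(a,b') ≤ e_n(a,b)` — a higher ceiling is
harder to reach from the origin above the same floor, at the same scale.

Proof. The raw events are NOT nested (a configuration containing a non-lattice pair `s(0, y)` joins
`0` to the level `b'·n` in one "open" step), so the inclusion is proved for lattice configurations
`ω ⊆ E(ℤ³)` only, which carry `P_{p_c}` (`DCT16.real_mono_of_forall_subset_edgeSet`). For such `ω`,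
an open connection inside `R` from `0` (level `0 ≤ b·n`) to `y` (level `b'·n ≥ b·n`) moves the
height `x₀` by at most one per step (`zdGraph_adj_apply_le`), so stopped at its FIRST VISIT to the
level `{x₀ = b·n}` (`exists_openConnIn_le_level`, the discrete intermediate value property) it is an
open connection inside `R ∩ {x₀ ≤ b·n} ⊆ R` from `0` to some `z` with `z₀ = b·n`
(`openConnIn_mono`): `ω ∈ E_n(a,b)`. Degenerate cases need no separate treatment (`a = 0` or
`n = 0`: `0 ∉ R`, the hypothesis event is empty; `b = 0`: `z = 0`).
-/

noncomputable section

namespace Summit.CriticalPhenomena.PercolationContinuityZ3.Theorems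

open MeasureTheory Filter Literature.Probability.Percolation Literature.Probability.LatticeModels

namespace LevelMono

/-- **Pointwise ceiling monotonicity on lattice configurations.** For `ω ⊆ E(ℤ³)`, if `ω` joins
`0` to a site `y` at level `y₀ = b'·n` by an open path inside `R = {z | -a·n < z₀}`, and `b ≤ b'`,
then `ω` joins `0` inside `R` to a site `z` at level `z₀ = b·n`: the first visit of the path to the
level `b·n` (`exists_openConnIn_le_level` with the `1`-Lipschitz height `z ↦ z₀`,
`zdGraph_adj_apply_le`). [folklore] -/
theorem climbEvent_anti_of_subset_edgeSet {a b b' n : ℕ} (hbb' : b ≤ b')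
    {ω : BondConfig (Site 3)} (hω : ω ⊆ (zdGraph 3).edgeSet)
    (h : ω ∈ {ω | ∃ y : Site 3, y 0 = ((b' * n : ℕ) : ℤ) ∧
      ω ∈ openConnIn {z : Site 3 | -((a * n : ℕ) : ℤ) < z 0} 0 y}) :
    ω ∈ {ω | ∃ y : Site 3, y 0 = ((b * n : ℕ) : ℤ) ∧
      ω ∈ openConnIn {z : Site 3 | -((a * n : ℕ) : ℤ) < z 0} 0 y} := by
  obtain ⟨y, hy, hconn⟩ := h
  have hbn : ((b * n : ℕ) : ℤ) ≤ y 0 := by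
    rw [hy]
    exact_mod_cast Nat.mul_le_mul_right n hbb'
  obtain ⟨z, hz, hr⟩ := exists_openConnIn_le_level (G := zdGraph 3) hω (fun w : Site 3 => w 0)
    (fun u w huw => (zdGraph_adj_apply_le huw 0).1) ((b * n : ℕ) : ℤ)
    (show (0 : Site 3) 0 ≤ ((b * n : ℕ) : ℤ) by rw [Pi.zero_apply]; exact_mod_cast Nat.zero_le _)
    hbn hconn
  exact ⟨z, hz, openConnIn_mono Set.inter_subset_left 0 z hr⟩

end LevelMono

open LevelMono in
/-- **STUB 1 of line `registered` (birth) of `BGNOffTheFloor` (`LevelMono`).** Ceiling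
monotonicity of the climb probability at criticality: for `b ≤ b'`,
`P_{p_c}(0 ⟷ {x₀ = b'·n} in {x₀ > -a·n}) ≤ P_{p_c}(0 ⟷ {x₀ = b·n} in {x₀ > -a·n})`.
By `DCT16.real_mono_of_forall_subset_edgeSet` it suffices to compare the events on lattice
configurations `ω ⊆ E(ℤ³)`, where the inclusion is
`LevelMono.climbEvent_anti_of_subset_edgeSet` (first visit of an open lattice path to the level
`b·n`). [folklore] -/
theorem stub_levelMono : ∀ a b b' n : ℕ, b ≤ b' →
    (bondPercolation (zdGraph 3) (criticalProbI 3)).real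
        {ω | ∃ y : Site 3, y 0 = ((b' * n : ℕ) : ℤ) ∧
          ω ∈ openConnIn {z : Site 3 | -((a * n : ℕ) : ℤ) < z 0} 0 y} ≤
      (bondPercolation (zdGraph 3) (criticalProbI 3)).real
        {ω | ∃ y : Site 3, y 0 = ((b * n : ℕ) : ℤ) ∧
          ω ∈ openConnIn {z : Site 3 | -((a * n : ℕ) : ℤ) < z 0} 0 y} := by
  intro a b b' n hbb'
  exact DCT16.real_mono_of_forall_subset_edgeSet (zdGraph 3) (criticalProbI 3)
    fun ω hω h => climbEvent_anti_of_subset_edgeSet hbb' hω h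

end Summit.CriticalPhenomena.PercolationContinuityZ3.Theorems

end
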